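import Literature.AnabelianGeometry.AbsoluteAnabelian.OneParameterSubgroupsPSL2RStructure
import Literature.AnabelianGeometry.AbsoluteAnabelian.OneParameterSubgroupsPSL2RRange
import Literature.AnabelianGeometry.AbsoluteAnabelian.OneParameterSubgroupsPSL2RLine
import Literature.AnabelianGeometry.AbsoluteAnabelian.ArchimedeanReconstruction
import Literature.Topology.Algebra.OneParameterSubgroupCircle
import Mathlib.Analysis.SpecialFunctions.Complex.Circle

/-!
# One-parameter subgroups of `PSL₂(ℝ)`, V: [AbsTopIII] Cor. 2.7 (d) DISCHARGED
# (`OneParameterSubgroupsPSL2R` holds)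

The named fact `Literature.AnabelianGeometry.AbsoluteAnabelian.OneParameterSubgroupsPSL2R` of
`ArchimedeanReconstruction.lean` ([MochizukiAbsTopIII2015] Corollary 2.7 (d) p.59, in the repaired
two-clause reading of the typing: for `G = SL₂(ℝ)/{±1}` and a subgroup `S`,
(1) `S` is the image of a continuous injective homomorphism `ℝ → G` iff `S` is closed, connected and
`S ∖ {1}` is disconnected; (2) `S` is the image of a continuous, non-injective, non-trivial
homomorphism `ℝ → G` iff `S` is closed and homeomorphic to a circle) is PROVED:
`oneParameterSubgroupsPSL2R_holds`.

Ingredients (parts I–IV): the Lie algebra and exponential chart of a closed subgroup (von Neumann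
/ Cartan, tree `ClosedSubgroupExpChart`), the trichotomy for closed connected subgroups,
one-parameter subgroups as lines/circles, no continuous injective additive map `ℝ → ℝ/pℤ`. Here
first: the closure `T` of the image of a continuous homomorphism `ℝ → G` is closed, connected and
ABELIAN, so its one-parameter groups have commuting, hence proportional, generators, `dim 𝔥_T ≤ 1`,
and the trichotomy leaves `T = 1` or `T = π(exp ℝX₀)` (`closure_range_cases`). Clause (2)(`→`)
holds in ANY Hausdorff group and is the tree's
`Literature.Topology.Algebra.oneParameter_range_isClosed_and_homeomorph_circle`
(`OneParameterSubgroupCircle.lean`, abc-iut seat w5-d104), used by name.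

Everything is a theorem (no definitions, no named facts). No side is taken on anything in
[IUTchIII]; this is classical Lie theory serving a cited reconstruction step of [AbsTopIII] §2 —
the fact stays consumable BY NAME; here it merely acquires a proof.
-/

noncomputable section

open NormedSpace Filter Topology Set

namespace Literature.AnabelianGeometry.AbsoluteAnabelian

namespace OneParameterSubgroupsPSL2R

open Matrix Literature.Analysis.Matrix

open scoped MatrixGroups

open scoped Matrix.Norms.Operator

-- As in `Mathlib/Analysis/Normed/Algebra/MatrixExponential.lean` and the tree's `DetExp.lean`: the
-- scoped `L∞`-operator normed ring structure on matrices is only reducibly-defeq to the Pi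
-- uniformity, so `CompleteSpace` and the analytic facts about `exp` need this setting.
set_option backward.isDefEq.respectTransparency false

/-! ### The closure of a one-parameter subgroup -/

/-- **The closure `T` of the image of a continuous homomorphism `ℝ → SL₂(ℝ)/{±1}` is trivial or a
one-parameter subgroup `π(exp ℝX₀)`** (`X₀ ≠ 0` traceless): `T` is closed, connected and abelian,
its one-parameter groups have commuting, hence proportional, generators, so `dim 𝔥_T ≤ 1` in the
trichotomy of part II. [cite: MochizukiAbsTopIII2015, Corollary 2.7 (d) p.59] -/
theorem closure_range_cases (f : Multiplicative ℝ →* (SL(2, ℝ) ⧸ Subgroup.center SL(2, ℝ)))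
    (hf : Continuous f) :
    f.range.topologicalClosure = ⊥ ∨
    ∃ X : Matrix (Fin 2) (Fin 2) ℝ, X.trace = 0 ∧ X ≠ 0 ∧
      ∃ φ : Multiplicative ℝ →* SL(2, ℝ), Continuous φ ∧
      (∀ t : ℝ, ((φ (Multiplicative.ofAdd t) : SL(2, ℝ)) : Matrix (Fin 2) (Fin 2) ℝ) = exp (t • X)) ∧
      ((QuotientGroup.mk' (Subgroup.center SL(2, ℝ))).comp φ).range = f.range.topologicalClosure := by
  haveI : IsClosed ((Subgroup.center SL(2, ℝ) : Subgroup SL(2, ℝ)) : Set SL(2, ℝ)) := isClosed_center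
  set T := f.range.topologicalClosure with hTdef
  have hT : IsClosed (T : Set (SL(2, ℝ) ⧸ Subgroup.center SL(2, ℝ))) := Subgroup.isClosed_topologicalClosure _
  have hconn : IsConnected (T : Set (SL(2, ℝ) ⧸ Subgroup.center SL(2, ℝ))) := by
    rw [hTdef, Subgroup.topologicalClosure_coe, MonoidHom.coe_range]
    have hr : Set.range f = Set.range (fun t : ℝ => f (Multiplicative.ofAdd t)) := by
      ext x; constructor
      · rintro ⟨t, rfl⟩; exact ⟨t.toAdd, by simp⟩
      · rintro ⟨t, rfl⟩; exact ⟨_, rfl⟩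
    rw [hr]
    exact (isConnected_range (hf.comp continuous_ofAdd)).closure
  -- `T` is commutative
  have hcommR : ∀ x y : f.range, x * y = y * x := by
    rintro ⟨x, s, rfl⟩ ⟨y, t, rfl⟩
    apply Subtype.ext
    change f s * f t = f t * f s
    rw [← map_mul, ← map_mul, mul_comm]
  have hcomm : ∀ a ∈ T, ∀ b ∈ T, a * b = b * a := by
    intro a ha b hb
    letI := Subgroup.commGroupTopologicalClosure f.range hcommR
    have := mul_comm (⟨a, ha⟩ : T) ⟨b, hb⟩
    exact congrArg Subtype.val this
  rcases structure_of_isClosed_of_isConnected T hT hconn with h | h | h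
  · exact Or.inl h
  · exact Or.inr h
  · -- `dim 𝔥 ≥ 2` is impossible for an abelian `T`
    exfalso
    obtain ⟨-, 𝔥, hmem, htr, hge, X, hX, hX0, -⟩ := h
    let W : Submodule ℝ (Matrix (Fin 2) (Fin 2) ℝ) := ℝ ∙ X
    have hW : Module.finrank ℝ W = 1 := finrank_span_singleton hX0
    have hnot : ¬ 𝔥 ≤ W := by
      intro hle
      have := Submodule.finrank_mono hle
      omega
    obtain ⟨Y, hY, hYW⟩ := SetLike.not_le_iff_exists.mp hnot
    have hc : X * Y = Y * X :=
      commute_of_exp_smul_commute fun s t =>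
        exp_smul_commute_of_comm T hcomm ((hmem X).mp hX) ((hmem Y).mp hY) s t
    obtain ⟨c, hcY⟩ := Matrix.traceless_two_exists_smul_of_commute (htr X hX) (htr Y hY) hX0 hc
    exact hYW (Submodule.mem_span_singleton.mpr ⟨c, hcY.symm⟩)

/-! ### The theorem -/

/-- **[AbsTopIII] Cor. 2.7 (d), the typed reading, HOLDS**: in `G = SL₂(ℝ)/{±1}`, (1) the images of
continuous injective homomorphisms `ℝ → G` are exactly the closed connected subgroups `S` with
`S ∖ {1}` disconnected (the hyperbolic and parabolic one-parameter subgroups), and (2) the images of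
continuous non-injective non-trivial homomorphisms `ℝ → G` are exactly the closed subgroups
homeomorphic to a circle (the elliptic ones). Proof: the exponential chart of a closed subgroup
(von Neumann–Cartan) reduces everything to the dimension of its Lie algebra `𝔥 ⊆ 𝔰𝔩₂(ℝ)`:
`dim 0` is the trivial group, `dim 1` a one-parameter subgroup `π(exp ℝX₀)` — a line or a circle
according to the sign of `det X₀`, by the closed forms of `exp (tX₀)` —, and `dim ≥ 2` gives a
connected `S ∖ {1}` and a non-compact `S`; closures of one-parameter subgroups are abelian, hence of
dimension `≤ 1`. (Assembly; the exported statement is `oneParameterSubgroupsPSL2R_holds` below.)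
[cite: MochizukiAbsTopIII2015, Corollary 2.7 (d) p.59] -/
private theorem holds_aux :
    Literature.AnabelianGeometry.AbsoluteAnabelian.OneParameterSubgroupsPSL2R := by
  haveI : IsClosed ((Subgroup.center SL(2, ℝ) : Subgroup SL(2, ℝ)) : Set SL(2, ℝ)) :=
    isClosed_center
  haveI : LocallyCompactSpace SL(2, ℝ) := locallyCompactSpace_SL2
  dsimp only [OneParameterSubgroupsPSL2R]
  refine ⟨fun S => ⟨?_, ?_⟩, fun S => ⟨?_, ?_⟩⟩
  · -- (1), `→`: an injective one-parameter subgroup is a closed line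
    rintro ⟨f, hf, hinj, rfl⟩
    have hfT : ∀ t, f t ∈ f.range.topologicalClosure :=
      fun t => Subgroup.le_topologicalClosure _ ⟨t, rfl⟩
    rcases closure_range_cases f hf with hbot | ⟨X, hX, hX0, φ, hφc, hφ, hrange⟩
    · exfalso
      have : f (Multiplicative.ofAdd 1) = f (Multiplicative.ofAdd 0) := by
        have h1 := hfT (Multiplicative.ofAdd 1)
        have h0 := hfT (Multiplicative.ofAdd 0)
        rw [hbot, Subgroup.mem_bot] at h1 h0
        rw [h1, h0]
      exact one_ne_zero (Multiplicative.ofAdd.injective (hinj this))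
    rcases le_or_gt X.det 0 with hdet | hdet
    · -- line: `f` maps onto the closure, which is therefore the (closed) image
      obtain ⟨e, he, hemul⟩ := exists_homeomorph_line _ (Subgroup.isClosed_topologicalClosure _)
        X hX hX0 hdet φ hφc hφ hrange
      obtain ⟨a, ha⟩ := exists_eq_line_smul _ e hemul f hf hfT
      have ha0 : a ≠ 0 := by
        rintro rfl
        have : f (Multiplicative.ofAdd 1) = f (Multiplicative.ofAdd 0) := by
          rw [ha, ha]; simp
        exact one_ne_zero (Multiplicative.ofAdd.injective (hinj this))
      have hsurj : f.range = f.range.topologicalClosure := by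
        refine le_antisymm (Subgroup.le_topologicalClosure _) fun y hy => ?_
        refine ⟨Multiplicative.ofAdd ((e.symm ⟨y, hy⟩).toAdd / a), ?_⟩
        rw [ha, div_mul_cancel₀ _ ha0, ofAdd_toAdd, Homeomorph.apply_symm_apply]
      have hclosed : IsClosed ((f.range : Subgroup _) : Set (SL(2, ℝ) ⧸ Subgroup.center SL(2, ℝ))) := by
        rw [hsurj]; exact Subgroup.isClosed_topologicalClosure _
      refine ⟨hclosed, ?_, ?_⟩
      · rw [MonoidHom.coe_range]
        have hr : Set.range f = Set.range (fun t : ℝ => f (Multiplicative.ofAdd t)) := by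
          ext x; constructor
          · rintro ⟨t, rfl⟩; exact ⟨t.toAdd, by simp⟩
          · rintro ⟨t, rfl⟩; exact ⟨_, rfl⟩
        rw [hr]
        exact isConnected_range (hf.comp continuous_ofAdd)
      · -- `S ∖ {1}` is a line minus a point
        have hrange' : ((QuotientGroup.mk' (Subgroup.center SL(2, ℝ))).comp φ).range = f.range := by
          rw [hrange, ← hsurj]
        obtain ⟨e', he', he'mul⟩ := exists_homeomorph_line f.range hclosed X hX hX0 hdet φ hφc hφ hrange'
        intro hpre
        have he'1 : e' 1 = 1 := by
          have h := he'mul 1 1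
          rw [mul_one] at h
          exact left_eq_mul.mp h
        have himg : (e'.symm : f.range → Multiplicative ℝ) '' ((Set.univ : Set f.range) \ {1}) =
            (Set.univ : Set (Multiplicative ℝ)) \ {1} := by
          rw [Set.image_sdiff e'.symm.injective, Set.image_univ_of_surjective e'.symm.surjective,
            Set.image_singleton, ← he'1, Homeomorph.symm_apply_apply]
        have := hpre.image e'.symm e'.symm.continuous.continuousOn
        rw [himg] at this
        exact not_isPreconnected_compl_one this
    · -- circle: impossible for an injective `f`
      exfalso
      obtain ⟨e, he, headd⟩ := exists_homeomorph_addCircle _ X hX hX0 hdet φ hφc hφ hrange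
      have hp : 0 < Real.pi / Real.sqrt X.det := div_pos Real.pi_pos (Real.sqrt_pos.mpr hdet)
      have hesymm : ∀ x y, e.symm (x * y) = e.symm x + e.symm y := by
        intro x y
        apply e.injective
        rw [headd, e.apply_symm_apply, e.apply_symm_apply, e.apply_symm_apply]
      let g : ℝ → AddCircle (Real.pi / Real.sqrt X.det) :=
        fun t => e.symm ⟨f (Multiplicative.ofAdd t), hfT _⟩
      have hgc : Continuous g := by
        have h1 : Continuous fun t : ℝ => (⟨f (Multiplicative.ofAdd t), hfT _⟩ : f.range.topologicalClosure) :=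
          (hf.comp continuous_ofAdd).subtype_mk _
        exact e.symm.continuous.comp h1
      have hgadd : ∀ s t, g (s + t) = g s + g t := by
        intro s t
        simp only [g]
        rw [← hesymm]
        congr 1
        apply Subtype.ext
        change f (Multiplicative.ofAdd (s + t)) = f (Multiplicative.ofAdd s) * f (Multiplicative.ofAdd t)
        rw [ofAdd_add, map_mul]
      have hginj : Function.Injective g := by
        intro s t hst
        have := congrArg Subtype.val (e.symm.injective hst)
        exact Multiplicative.ofAdd.injective (hinj this)
      exact not_injective_of_continuous_additive hp g hgc hgadd hginj
  · -- (1), `←`: a closed connected `S` with `S ∖ {1}` disconnected is a hyperbolic/parabolic line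
    rintro ⟨hS, hconn, hnot⟩
    rcases structure_of_isClosed_of_isConnected S hS hconn with
      hbot | ⟨X, hX, hX0, φ, hφc, hφ, hrange⟩ | ⟨hpre, -⟩
    · exfalso
      apply hnot
      have : (Set.univ : Set S) \ {1} = ∅ := by
        ext s
        simp only [Set.mem_sdiff, Set.mem_univ, true_and, Set.mem_singleton_iff, Set.mem_empty_iff_false,
          iff_false, not_not]
        apply Subtype.ext
        have h' : (s : SL(2, ℝ) ⧸ Subgroup.center SL(2, ℝ)) ∈ (⊥ : Subgroup _) := by
          rw [← hbot]; exact s.2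
        exact Subgroup.mem_bot.mp h'
      rw [this]; exact isPreconnected_empty
    · rcases le_or_gt X.det 0 with hdet | hdet
      · refine ⟨(QuotientGroup.mk' (Subgroup.center SL(2, ℝ))).comp φ,
          QuotientGroup.continuous_mk.comp hφc, ?_, hrange⟩
        refine (injective_iff_map_eq_one _).mpr fun t ht => ?_
        exact (mk_expHom_eq_one_iff_of_det_nonpos X hX hX0 hdet φ hφ t).mp ht
      · -- an elliptic one-parameter subgroup has connected `S ∖ {1}`: contradiction
        exfalso
        apply hnot
        set p : ℝ := Real.pi / Real.sqrt X.det with hpdef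
        have hp : 0 < p := div_pos Real.pi_pos (Real.sqrt_pos.mpr hdet)
        let f := (QuotientGroup.mk' (Subgroup.center SL(2, ℝ))).comp φ
        have hfS : ∀ t, f t ∈ S := fun t => hrange ▸ ⟨t, rfl⟩
        have hker : ∀ u : ℝ, f (Multiplicative.ofAdd u) = 1 ↔ ∃ k : ℤ, u = k * p := fun u =>
          mk_expHom_eq_one_iff_of_det_pos X hX hX0 hdet φ hφ u
        let F : ℝ → S := fun t => ⟨f (Multiplicative.ofAdd t), hfS _⟩
        have hFc : Continuous F :=
          ((QuotientGroup.continuous_mk.comp hφc).comp continuous_ofAdd).subtype_mk _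
        have hper : ∀ (t : ℝ) (n : ℤ), F (t - n * p) = F t := by
          intro t n
          apply Subtype.ext
          change f (Multiplicative.ofAdd (t - n * p)) = f (Multiplicative.ofAdd t)
          have h1 : f (Multiplicative.ofAdd (-(n * p))) = 1 := (hker _).mpr ⟨-n, by push_cast; ring⟩
          rw [sub_eq_add_neg, ofAdd_add, map_mul, h1, mul_one]
        have himg : (Set.univ : Set S) \ {1} = F '' Set.Ioo 0 p := by
          ext s
          constructor
          · rintro ⟨-, hs1⟩
            obtain ⟨t, ht⟩ : ∃ t : Multiplicative ℝ, f t = s := by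
              have h' : (s : SL(2, ℝ) ⧸ Subgroup.center SL(2, ℝ)) ∈
                  ((QuotientGroup.mk' (Subgroup.center SL(2, ℝ))).comp φ).range := by
                rw [hrange]; exact s.2
              exact h'
            set n : ℤ := ⌊t.toAdd / p⌋ with hn
            have h0 : (0 : ℝ) ≤ t.toAdd - n * p := by
              have := Int.floor_le (t.toAdd / p)
              rw [← hn] at this
              have : (n : ℝ) * p ≤ t.toAdd := by rwa [le_div_iff₀ hp] at this
              linarith
            have h1 : t.toAdd - n * p < p := by
              have := Int.lt_floor_add_one (t.toAdd / p)
              rw [← hn] at this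
              have : t.toAdd < (n + 1) * p := by rwa [div_lt_iff₀ hp] at this
              linarith
            refine ⟨t.toAdd - n * p, ⟨lt_of_le_of_ne h0 ?_, h1⟩, ?_⟩
            · intro h
              apply hs1
              rw [Set.mem_singleton_iff]
              apply Subtype.ext
              have hF0 : F (t.toAdd - n * p) = F t.toAdd := hper t.toAdd n
              rw [← h] at hF0
              have hval := congrArg Subtype.val hF0
              change f (Multiplicative.ofAdd 0) = f (Multiplicative.ofAdd t.toAdd) at hval
              rw [ofAdd_toAdd, ofAdd_zero, map_one] at hval
              rw [← ht]
              exact hval.symm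
            · rw [hper]
              apply Subtype.ext
              change f (Multiplicative.ofAdd t.toAdd) = _
              rw [ofAdd_toAdd]
              exact ht
          · rintro ⟨t, ⟨ht0, htp⟩, rfl⟩
            refine ⟨Set.mem_univ _, fun h1 => ?_⟩
            rw [Set.mem_singleton_iff] at h1
            have h1' : f (Multiplicative.ofAdd t) = 1 := congrArg Subtype.val h1
            obtain ⟨k, hk⟩ := (hker t).mp h1'
            have hk0 : (0 : ℝ) < k := by
              by_contra hle
              have : (k : ℝ) * p ≤ 0 := mul_nonpos_of_nonpos_of_nonneg (not_lt.mp hle) hp.le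
              linarith
            have hk1 : (k : ℝ) < 1 := by
              by_contra hle
              have : p ≤ (k : ℝ) * p := by nlinarith [not_lt.mp hle]
              linarith
            have hk0' : (0 : ℤ) < k := by exact_mod_cast hk0
            have hk1' : k < (1 : ℤ) := by exact_mod_cast hk1
            omega
        rw [himg]
        exact isPreconnected_Ioo.image F hFc.continuousOn
    · exact absurd hpre hnot
  · -- (2), `→`: a non-injective non-trivial one-parameter subgroup of ANY Hausdorff group is a
    -- closed circle (`Literature.Topology.Algebra.oneParameter_range_isClosed_and_homeomorph_circle`)
    rintro ⟨f, hf, hninj, hne, rfl⟩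
    exact Literature.Topology.Algebra.oneParameter_range_isClosed_and_homeomorph_circle f hf hninj hne
  · -- (2), `←`: a closed subgroup homeomorphic to a circle is an elliptic one-parameter subgroup
    rintro ⟨hS, ⟨e⟩⟩
    haveI : CompactSpace S := e.symm.compactSpace
    have hK : IsCompact (S : Set (SL(2, ℝ) ⧸ Subgroup.center SL(2, ℝ))) :=
      isCompact_iff_compactSpace.mpr inferInstance
    -- the circle, hence `S`, is connected
    haveI hconnC : ConnectedSpace Circle := by
      rw [connectedSpace_iff_univ]
      have h1 : IsConnected (Set.range ((↑) : ℝ → AddCircle (2 * Real.pi))) :=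
        isConnected_range (QuotientAddGroup.continuous_mk (N := AddSubgroup.zmultiples (2 * Real.pi)))
      have h2 := h1.image _ AddCircle.homeomorphCircle'.continuous.continuousOn
      rwa [← Set.range_comp, (AddCircle.homeomorphCircle'.surjective.comp
        (QuotientAddGroup.mk_surjective)).range_eq] at h2
    have hunivS : IsConnected (Set.univ : Set S) := by
      rw [← e.symm.surjective.range_eq]
      exact isConnected_range e.symm.continuous
    have hconn : IsConnected (S : Set (SL(2, ℝ) ⧸ Subgroup.center SL(2, ℝ))) :=
      isConnected_iff_connectedSpace.mpr (connectedSpace_iff_univ.mpr hunivS)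
    rcases structure_of_isClosed_of_isConnected S hS hconn with
      hbot | ⟨X, hX, hX0, φ, hφc, hφ, hrange⟩ | ⟨-, 𝔥, hmem, htr, -, X, hX𝔥, hX0, hdet⟩
    · -- the trivial group is not a circle
      exfalso
      have hsub : ∀ a b : S, a = b := by
        intro a b
        apply Subtype.ext
        have ha : (a : SL(2, ℝ) ⧸ Subgroup.center SL(2, ℝ)) ∈ (⊥ : Subgroup _) := by
          rw [← hbot]; exact a.2
        have hb : (b : SL(2, ℝ) ⧸ Subgroup.center SL(2, ℝ)) ∈ (⊥ : Subgroup _) := by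
          rw [← hbot]; exact b.2
        rw [Subgroup.mem_bot.mp ha, Subgroup.mem_bot.mp hb]
      have h2 : e.symm (Circle.exp Real.pi) = e.symm 1 := hsub _ _
      exact Circle.exp_pi_ne_one (e.symm.injective h2)
    · rcases le_or_gt X.det 0 with hdet | hdet
      · exfalso
        refine not_isCompact_of_nonElliptic S hK X hX hX0 hdet fun t => ?_
        exact ⟨φ (Multiplicative.ofAdd t), hφ t, hrange ▸ ⟨Multiplicative.ofAdd t, rfl⟩⟩
      · set p : ℝ := Real.pi / Real.sqrt X.det with hpdef
        have hp : 0 < p := div_pos Real.pi_pos (Real.sqrt_pos.mpr hdet)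
        have hker : ∀ u : ℝ, ((QuotientGroup.mk' (Subgroup.center SL(2, ℝ))).comp φ)
            (Multiplicative.ofAdd u) = 1 ↔ ∃ k : ℤ, u = k * p := fun u =>
          mk_expHom_eq_one_iff_of_det_pos X hX hX0 hdet φ hφ u
        refine ⟨(QuotientGroup.mk' (Subgroup.center SL(2, ℝ))).comp φ,
          QuotientGroup.continuous_mk.comp hφc, ?_, ?_, hrange⟩
        · -- not injective: `p ↦ 1`
          intro hinj
          have h1 : ((QuotientGroup.mk' (Subgroup.center SL(2, ℝ))).comp φ) (Multiplicative.ofAdd p) =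
              ((QuotientGroup.mk' (Subgroup.center SL(2, ℝ))).comp φ) (Multiplicative.ofAdd 0) := by
            rw [(hker p).mpr ⟨1, by simp⟩, (hker 0).mpr ⟨0, by simp⟩]
          exact hp.ne' (Multiplicative.ofAdd.injective (hinj h1))
        · -- not trivial: `p/2 ↦ π(exp (p/2) X) ≠ 1`
          intro h1
          have := DFunLike.congr_fun h1 (Multiplicative.ofAdd (p / 2))
          rw [MonoidHom.one_apply, hker] at this
          obtain ⟨k, hk⟩ := this
          have : (2 * k - 1 : ℝ) * p = 0 := by linarith
          have h2 : (2 * k - 1 : ℝ) = 0 := by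
            rcases mul_eq_zero.mp this with h | h
            · exact h
            · exact absurd h hp.ne'
          have h3 : (2 * k - 1 : ℤ) = 0 := by exact_mod_cast h2
          omega
    · exact (not_isCompact_of_nonElliptic S hK X (htr X hX𝔥) hX0 hdet ((hmem X).mp hX𝔥)).elim

end OneParameterSubgroupsPSL2R

/-- **[AbsTopIII] Corollary 2.7 (d), the typed reading `OneParameterSubgroupsPSL2R`, HOLDS**: in
`G = SL₂(ℝ)/{±1}`, (1) the images of continuous injective homomorphisms `ℝ → G` are exactly the
closed connected subgroups `S` with `S ∖ {1}` disconnected (the hyperbolic and parabolic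
one-parameter subgroups), and (2) the images of continuous non-injective non-trivial homomorphisms
`ℝ → G` are exactly the closed subgroups homeomorphic to a circle (the elliptic ones). The FACT-LIST
row F-0064 of the abc-iut cell thereby acquires a kernel proof (the fact stays consumable by name).
[cite: MochizukiAbsTopIII2015, Corollary 2.7 (d) p.59] -/
theorem oneParameterSubgroupsPSL2R_holds :
    Literature.AnabelianGeometry.AbsoluteAnabelian.OneParameterSubgroupsPSL2R :=
  OneParameterSubgroupsPSL2R.holds_aux

end Literature.AnabelianGeometry.AbsoluteAnabelian

end
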